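import Summits.CriticalPhenomena.CardyFormulaZ2.Theorems.CardyComplexConeParafermionToSLESixFamiliesDiamondTurnCountLocal
import Summits.CriticalPhenomena.CardyFormulaZ2.Theorems.CardyComplexConeParafermionToSLESixFamiliesDiamondTraceLayers
import HarnessLib

/-!
# The first boundary dart of a straight side, locally: its orientation, its layer, its frame
# (line `potential-darboux-picard-diamond`, S1p `stub_boundaryDartPhase`, part 4)

Crux `ParafermionToSLESixFamilies` (stmt-CriticalPhenomena-11389), line `potential-darboux-picard-diamond`, stub
`stub_boundaryDartPhase` (S1p). `BoundaryDartPhase` speaks of a corner `(x, j)` with inner face near the bulk of a boundary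
segment on side `k` of the marked diamond whose two outward neighbours `x + u_{j+1}`, `x + u_{j+2}` lie on the discrete arc of
the side — FREE: `x ∉ B`, the neighbours on `B`; WIRED: `x` and the neighbours on `A` — for an ARBITRARY index `j`. This file
pins `j` and reads off what the escape staircase needs, in the frame of side `k` (`Fk`, `Gk`, `xiC`, `upC` of
`…DiamondTurnCountFrame.lean`):

* `boundarySite_frame` — a discrete-boundary site `b` in the bulk of side `k` lies within `2δ` of the side in the frame
  (`gam - 2δ < Fk`), and the half-plane two layers further out (`xiC - upC ≥ xiC b - upC b + 2`) is outside the diamond;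
* `freeSite_pin` — for a free dart `j = k + 2` (so S1t's `turnCount_touchSite` applies to it verbatim);
* `wiredSite_local` (registered) — for a wired dart `j = k + 2`; `x` and its inward neighbour `x + u_{k+1}` (the base of the
  wired prefix) are sites of the diamond, the base lies in the frame window of the route interface (`route_cases`, window
  widened by `δ`), the half-plane `xiC - upC ≥ xiC x - upC x + 2` is outside, and no site of the frame block of `ℓ¹`-radius
  three around `x` is on `B`;
* the three faces used by the wired escape at `x` and `x + u_k` seen from their outer corner (`faceAt_wired₁/₂/₃`).
-/

noncomputable section

namespace Summit.CriticalPhenomena.CardyFormulaZ2.Cruxes.ParafermionToSLESixFamilies.PotentialDarbouxPicardDiamond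

open Set Metric Complex
open Literature.Probability Literature.Probability.LatticeModels Literature.Probability.Percolation
open Literature.Probability.LatticeModels.DiscreteDobrushin
open Literature.Probability.RandomPlanarGeometry

/-! ## Frame blocks -/

/-- A mesh point moves by at most `m δ` within a frame block of `ℓ¹`-radius `m`. -/
theorem norm_meshPoint_sub_le_of_l1 {δ : ℝ} (hδ : 0 ≤ δ) (k : Fin 4) {v w : Site 2} {m : ℕ}
    (h : |xiC k w - xiC k v| + |upC k w - upC k v| ≤ m) : ‖meshPoint δ w - meshPoint δ v‖ ≤ m * δ := by
  have hl1 : |w 0 - v 0| + |w 1 - v 1| ≤ m := by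
    have e0 : |-w 0 + v 0| = |w 0 - v 0| := by rw [neg_add_eq_sub, abs_sub_comm]
    have e1 : |-w 1 + v 1| = |w 1 - v 1| := by rw [neg_add_eq_sub, abs_sub_comm]
    fin_cases k <;> simp [xiC, upC] at h
    · exact h
    · rw [e0] at h; linarith
    · rw [e0, e1] at h; exact h
    · rw [e1] at h; linarith
  have hre : (meshPoint δ w - meshPoint δ v).re = δ * (w 0 - v 0 : ℤ) := by simp [mul_sub]
  have him : (meshPoint δ w - meshPoint δ v).im = δ * (w 1 - v 1 : ℤ) := by simp [mul_sub]
  have hl1' : (|(w 0 - v 0 : ℤ)| : ℝ) + |((w 1 - v 1 : ℤ) : ℝ)| ≤ m := by exact_mod_cast hl1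
  calc ‖meshPoint δ w - meshPoint δ v‖ ≤ |(meshPoint δ w - meshPoint δ v).re| + |(meshPoint δ w - meshPoint δ v).im| :=
        Complex.norm_le_abs_re_add_abs_im _
    _ = δ * (|((w 0 - v 0 : ℤ) : ℝ)| + |((w 1 - v 1 : ℤ) : ℝ)|) := by
        rw [hre, him, abs_mul, abs_mul, abs_of_nonneg hδ]; ring
    _ ≤ δ * m := mul_le_mul_of_nonneg_left hl1' hδ
    _ = m * δ := mul_comm _ _

/-! ## The three faces of the wired escape, seen from their outer corner -/

/-- The face across the outward diagonal at `x`: `faceAt x (k + 3) = faceAt (x + u_k + u_{k+3}) (k + 1)`. -/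
theorem faceAt_wired₁ (x : Site 2) (k : Fin 4) : faceAt x (k + 3) = faceAt (x + cornerUnit k + cornerUnit (k + 3)) (k + 1) := by
  have : ∀ k : Fin 4, cornerOff (k + 1) - cornerOff (k + 3) = cornerUnit k + cornerUnit (k + 3) := by decide
  rw [faceAt, faceAt, add_assoc x, ← this]; abel

/-- The face `k + 2` at `x + u_k`: `faceAt (x + u_k) (k + 2) = faceAt (x + u_k + u_{k+3}) (k + 1)`. -/
theorem faceAt_wired₂ (z : Site 2) (k : Fin 4) : faceAt z (k + 2) = faceAt (z + cornerUnit (k + 3)) (k + 1) := by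
  have : ∀ k : Fin 4, cornerOff (k + 1) - cornerOff (k + 2) = cornerUnit (k + 3) := by decide
  simp only [faceAt, ← this]; abel

/-- The face `k + 3` at `x + u_k`: `faceAt (x + u_k) (k + 3) = faceAt (x + u_k + u_{k+3}) k`. -/
theorem faceAt_wired₃ (z : Site 2) (k : Fin 4) : faceAt z (k + 3) = faceAt (z + cornerUnit (k + 3)) k := by
  have : ∀ k : Fin 4, cornerOff k - cornerOff (k + 3) = cornerUnit (k + 3) := by decide
  simp only [faceAt, ← this]; abel

/-! ## Discrete-boundary sites in the bulk of a side -/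

section Frame

variable {D : DobrushinDomain} {c : ℂ} {α β : ℝ} {E : DiscreteDobrushin} {δ : ℝ} {k : Fin 4}

/-- **A discrete-boundary site in the bulk of side `k` sits within two layers of the side, and two layers further out is
outside.** `b ∈ E.zdBoundary` whose frame block stays away from the three other sides (`|Gk| + 4δ ≤ gam'`,
`Fk ≥ -gam + 4δ`): then `gam - 2δ < Fk (δ b)`, and every lattice point `v` with `xiC v - upC v ≥ xiC b - upC b + 2` is off
the diamond (the block of `b` contains an outside point, which can only violate the constraint of side `k`). -/
theorem boundarySite_frame (hcar : D.carrier = {z | |(dRot c z).re| < α ∧ |(dRot c z).im| < β})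
    (hgood : ∀ x : Site 2, meshPoint δ x ∈ D.carrier → x ∈ meshDomain D.carrier δ) (hEΩ : E.Ω = D.carrier) (hEδ : E.δ = δ)
    (hδ : 0 < δ) {b : Site 2} (hb : b ∈ E.zdBoundary) (hGb : |Gk k (dRot c (meshPoint δ b))| + 4 * δ ≤ gam' α β k)
    (hFb : -gam α β k + 4 * δ ≤ Fk k (dRot c (meshPoint δ b))) :
    gam α β k - 2 * δ < Fk k (dRot c (meshPoint δ b)) ∧
      ∀ v : Site 2, xiC k b - upC k b + 2 ≤ xiC k v - upC k v → meshPoint δ v ∉ D.carrier := by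
  have hconv : Convex ℝ D.carrier := by rw [hcar]; exact convex_tiltedBox c _ α β
  obtain ⟨hh1, hh2⟩ := sqrt_two_div_two_mul_bounds hδ
  obtain ⟨y, hy1, hyout⟩ := exists_near_not_mem_of_mem_zdBoundary hconv hgood hEΩ hEδ hb
  obtain ⟨hyx, hyu⟩ := abs_xiC_upC_sub_le_one (k := k) hy1
  rw [abs_le] at hyx hyu
  obtain ⟨hFy, hGy⟩ := abs_frame_sub_le (c := c) hδ k y b (m := 2) (by rw [abs_le]; constructor <;> omega)
    (by rw [abs_le]; constructor <;> omega)
  rw [abs_le] at hFy hGy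
  have hGb' := abs_le.1 (show |Gk k (dRot c (meshPoint δ b))| ≤ gam' α β k - 4 * δ by linarith)
  have hFy0 : gam α β k ≤ Fk k (dRot c (meshPoint δ y)) := by
    have hny := hyout
    rw [mem_carrier_iff_frame hcar k, not_and_or, not_lt, not_lt] at hny
    rcases hny with hny | hny
    · rcases (le_abs'.1 hny) with h | h
      · exfalso; push_cast at hFy; linarith
      · exact h
    · exfalso
      rcases (le_abs'.1 hny) with h | h <;> push_cast at hGy <;> linarith
  have eF := Fk_meshPoint_sub c δ k b y
  have hge : (-2 : ℝ) ≤ ((xiC k b - upC k b - (xiC k y - upC k y) : ℤ) : ℝ) := by exact_mod_cast (by omega)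
  have m1 : Real.sqrt 2 / 2 * δ * (-2) ≤ Real.sqrt 2 / 2 * δ * ((xiC k b - upC k b - (xiC k y - upC k y) : ℤ) : ℝ) :=
    mul_le_mul_of_nonneg_left hge (by positivity)
  refine ⟨by nlinarith, fun v hv => ?_⟩
  apply not_mem_carrier_of_frame hcar k
  left
  have h1 := Fk_meshPoint_sub c δ k v y
  have h2 : (0:ℝ) ≤ Real.sqrt 2 / 2 * δ * (((xiC k v - upC k v - (xiC k y - upC k y)) : ℤ) : ℝ) := by
    apply mul_nonneg (by positivity)
    exact_mod_cast (by omega : (0:ℤ) ≤ xiC k v - upC k v - (xiC k y - upC k y))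
  linarith

end Frame

/-! ## The dart of a side, locally -/

section Dart

variable {D : DobrushinDomain} {c : ℂ} {α β : ℝ} {k : Fin 4} {sp sq : ℝ} {p q : ℂ} {E : DiscreteDobrushin} {δ η : ℝ}
  (hcar : D.carrier = {z | |(dRot c z).re| < α ∧ |(dRot c z).im| < β}) (hsp0 : 0 ≤ sp) (hsqL : sq ≤ dLen α β k)
  (hpk : dRot c p = dParam α β k sp) (hqk : dRot c q = dParam α β k sq) (hspq : sp ≤ sq) (hδ : 0 < δ) (hδη : 100 * δ ≤ η)
  (hδγ : 10 * δ ≤ gam α β k) (hEΩ : E.Ω = D.carrier) (hEδ : E.δ = δ)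
  (hgood : ∀ x : Site 2, meshPoint δ x ∈ D.carrier → x ∈ meshDomain D.carrier δ)
  {x : Site 2} (hdist : infDist (meshPoint δ x) (segment ℝ p q) ≤ 3 * δ) (hηp : η ≤ dist (meshPoint δ x) p)
  (hηq : η ≤ dist (meshPoint δ x) q) (hxin : meshPoint δ x ∈ D.carrier)

include hcar hsp0 hsqL hpk hqk hspq hδ hδη hδγ hEΩ hEδ hgood hdist hηp hηq hxin

/-- **The block lemma at a dart site.** For a site `x` of the diamond within `3δ` of the segment and `η`-away from its ends:
its frame window, the `3δ`-neighbourhood of `δx` is within `6δ` of the segment and `η/2`-away from its ends, and every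
discrete-boundary site `b` of the frame block of radius one around `x` satisfies the conclusion of `boundarySite_frame`. -/
theorem dartSite_block :
    (gam α β k - 3 * δ ≤ Fk k (dRot c (meshPoint δ x)) ∧ Fk k (dRot c (meshPoint δ x)) < gam α β k ∧
      sp + η - 6 * δ - gam' α β k ≤ Gk k (dRot c (meshPoint δ x)) ∧ Gk k (dRot c (meshPoint δ x)) ≤ sq - η + 6 * δ - gam' α β k) ∧
    (∀ v : Site 2, ‖meshPoint δ v - meshPoint δ x‖ ≤ 3 * δ →
      infDist (meshPoint δ v) (segment ℝ p q) ≤ 6 * δ ∧ η / 2 ≤ dist (meshPoint δ v) p ∧ η / 2 ≤ dist (meshPoint δ v) q) ∧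
    (∀ b : Site 2, |xiC k b - xiC k x| ≤ 1 → |upC k b - upC k x| ≤ 1 → b ∈ E.zdBoundary →
      gam α β k - 2 * δ < Fk k (dRot c (meshPoint δ b)) ∧
        ∀ v : Site 2, xiC k b - upC k b + 2 ≤ xiC k v - upC k v → meshPoint δ v ∉ D.carrier) := by
  rw [dLen_eq] at hsqL
  obtain ⟨hFx1, -, hGx1, hGx2⟩ := frame_of_near_segment α β c k sp sq p q hpk hqk hspq (meshPoint δ x) (3 * δ) η hdist hηp hηq
  have hFx2 : Fk k (dRot c (meshPoint δ x)) < gam α β k := by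
    have := (mem_carrier_iff_frame hcar k _).1 hxin
    exact (abs_lt.1 this.1).2
  refine ⟨⟨hFx1, hFx2, by linarith, by linarith⟩, fun v hv => ?_, fun b hb1 hb2 hb => ?_⟩
  · rw [← dist_eq_norm] at hv
    refine ⟨?_, ?_, ?_⟩
    · have := infDist_le_infDist_add_dist (s := segment ℝ p q) (x := meshPoint δ v) (y := meshPoint δ x)
      linarith
    · have := dist_triangle (meshPoint δ x) (meshPoint δ v) p
      rw [dist_comm] at hv; linarith
    · have := dist_triangle (meshPoint δ x) (meshPoint δ v) q
      rw [dist_comm] at hv; linarith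
  · have hb1' := abs_le.1 hb1
    have hb2' := abs_le.1 hb2
    obtain ⟨hFb, hGb⟩ := abs_frame_sub_le (c := c) hδ k b x (m := 2) (by rw [abs_le]; constructor <;> omega)
      (by rw [abs_le]; constructor <;> omega)
    rw [abs_le] at hFb hGb
    push_cast at hFb hGb
    refine boundarySite_frame hcar hgood hEΩ hEδ hδ hb ?_ ?_
    · have : |Gk k (dRot c (meshPoint δ b))| ≤ gam' α β k - η + 8 * δ := by
        rw [abs_le]; constructor <;> linarith
      linarith
    · linarith

/-- **The orientation of a free dart is that of the side**: `x ∉ B` with `x + u_{j+1}, x + u_{j+2} ∈ B` and `faceAt x j`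
inner, near the bulk of a free segment on side `k` (no `A`-site, boundary sites on `B`), forces `j = k + 2`. -/
theorem freeSite_pin
    (harcs : ∀ v : Site 2, infDist (meshPoint δ v) (segment ℝ p q) ≤ 6 * δ → η / 2 ≤ dist (meshPoint δ v) p →
      η / 2 ≤ dist (meshPoint δ v) q → v ∉ E.zdArcA ∧ (v ∈ E.zdBoundary → v ∈ E.zdArcB))
    {j : Fin 4} (hface : E.IsInnerFace (faceAt x j)) (hxB : x ∉ E.zdArcB) (hb1 : x + cornerUnit (j + 1) ∈ E.zdArcB)
    (hb2 : x + cornerUnit (j + 2) ∈ E.zdArcB) : j = k + 2 := by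
  obtain ⟨-, hnear, hbd⟩ := dartSite_block hcar hsp0 hsqL hpk hqk hspq hδ hδη hδγ hEΩ hEδ hgood hdist hηp hηq hxin
  have hxD : x ∈ meshDomain E.Ω E.δ := by rw [hEΩ, hEδ]; exact hgood x hxin
  -- `x` is off the discrete boundary
  have hxbd : x ∉ E.zdBoundary := by
    intro h
    obtain ⟨h1, h2, h3⟩ := hnear x (by rw [sub_self, norm_zero]; positivity)
    exact hxB ((harcs x h1 h2 h3).2 h)
  obtain ⟨m, rfl⟩ := exists_eq_add (k + 2) j
  have e1 : ∀ k : Fin 4, k + 2 + 1 + 1 = k ∧ k + 2 + 1 + 2 = k + 1 := by decide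
  have e2 : ∀ k : Fin 4, k + 2 + 2 + 1 = k + 1 ∧ k + 2 + 2 = k := by decide
  have e3 : ∀ k : Fin 4, k + 2 + 3 + 1 = k + 2 ∧ k + 2 + 3 + 2 = k + 3 := by decide
  fin_cases m
  · simp
  · -- `j = k + 3`: the neighbour `x + u_{k+1}` on `B` puts `x + u_k` outside, yet it is on `B`
    exfalso
    simp only [Fin.mk_one] at hb1 hb2
    rw [(e1 k).1] at hb1
    rw [(e1 k).2] at hb2
    obtain ⟨-, hout⟩ := hbd (x + cornerUnit (k + 1)) (by simp) (by simp) (E.zdArcB_subset_zdBoundary hb2)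
    have h1 : meshPoint δ (x + cornerUnit k) ∉ D.carrier := hout _ (by simp; omega)
    have h2 := mem_of_mem_zdBoundary (E.zdArcB_subset_zdBoundary hb1)
    rw [hEΩ, hEδ] at h2
    exact h1 h2
  · -- `j = k`: `x + u_{k+1}` on `B` puts `x + u_k` outside, so `x` is a boundary site
    exfalso
    simp only [Fin.reduceFinMk] at hb1 hface
    rw [(e2 k).1] at hb1
    obtain ⟨-, hout⟩ := hbd (x + cornerUnit (k + 1)) (by simp) (by simp) (E.zdArcB_subset_zdBoundary hb1)
    have h1 : meshPoint E.δ (x + cornerUnit k) ∉ E.Ω := by rw [hEΩ, hEδ]; exact hout _ (by simp; omega)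
    exact hxbd (mem_zdBoundary_of_adj_not_mem_carrier hxD (cSrc_mem_edgeSet (x, k)) h1)
  · -- `j = k + 1`: `x + u_{k+2}` on `B` puts `x + u_{k+3}` outside, yet it is on `B`
    exfalso
    simp only [Fin.reduceFinMk] at hb1 hb2
    rw [(e3 k).1] at hb1
    rw [(e3 k).2] at hb2
    obtain ⟨-, hout⟩ := hbd (x + cornerUnit (k + 2)) (by simp) (by simp) (E.zdArcB_subset_zdBoundary hb1)
    have h1 : meshPoint δ (x + cornerUnit (k + 3)) ∉ D.carrier := hout _ (by simp; omega)
    have h2 := mem_of_mem_zdBoundary (E.zdArcB_subset_zdBoundary hb2)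
    rw [hEΩ, hEδ] at h2
    exact h1 h2

end Dart

/-- **The first dart of the wired arc, locally** (registered helper of `stub_boundaryDartPhase`). See the module docstring. -/
theorem wiredSite_local : ∀ (D : DobrushinDomain) (c : ℂ) (α β : ℝ), D.carrier = {z | |((z - c) * exp (-(Real.pi / 4 : ℝ) * I)).re| < α ∧ |((z - c) * exp (-(Real.pi / 4 : ℝ) * I)).im| < β} → ∀ (k : Fin 4) (sp sq : ℝ) (p q : ℂ), 0 ≤ sp → sq ≤ dLen α β k → dRot c p = dParam α β k sp → dRot c q = dParam α β k sq → sp ≤ sq → ∀ (E : DiscreteDobrushin) (δ η : ℝ), 0 < δ → 100 * δ ≤ η → 10 * δ ≤ gam α β k → E.Ω = D.carrier → E.δ = δ → (∀ x : Site 2, meshPoint δ x ∈ D.carrier → x ∈ meshDomain D.carrier δ) → (∀ x : Site 2, infDist (meshPoint δ x) (segment ℝ p q) ≤ 6 * δ → η / 2 ≤ dist (meshPoint δ x) p → η / 2 ≤ dist (meshPoint δ x) q → x ∉ E.zdArcB ∧ (x ∈ E.zdBoundary → x ∈ E.zdArcA)) → ∀ (x : Site 2) (j : Fin 4), infDist (meshPoint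 δ x) (segment ℝ p q) ≤ 3 * δ → η ≤ dist (meshPoint δ x) p → η ≤ dist (meshPoint δ x) q → E.IsInnerFace (faceAt x j) → x ∈ E.zdArcA → x + cornerUnit (j + 1) ∈ E.zdArcA → x + cornerUnit (j + 2) ∈ E.zdArcA → j = k + 2 ∧ meshPoint δ x ∈ D.carrier ∧ meshPoint δ (x + cornerUnit (k + 1)) ∈ D.carrier ∧ (gam α β k - 3 * δ ≤ Fk k (dRot c (meshPoint δ (x + cornerUnit (k + 1)))) ∧ Fk k (dRot c (meshPoint δ (x + cornerUnit (k + 1)))) < gam α β k ∧ sp + η - 7 * δ - gam' α β k ≤ Gk k (dRot c (meshPoint δ (x + cornerUnit (k + 1)))) ∧ Gk k (dRot c (meshPoint δ (x + cornerUnit (k + 1)))) ≤ sq - η + 7 * δ - gam' α β k) ∧ (∀ v : Site 2, xiC k x - upC k x + 2 ≤ xiC k v - upC k v → meshPoint δ v ∉ D.carrier) ∧ (∀ v : Site 2, |xiC k v - xiC k x| + |upC k v - upC k x| ≤ 3 → v ∉ E.zdArcB) := by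
  intro D c α β hcar k sp sq p q hsp0 hsqL hpk hqk hspq E δ η hδ hδη hδγ hEΩ hEδ hgood harcs x j hdist hηp hηq hface hxA hA1 hA2
  have hcar' : D.carrier = {z | |(dRot c z).re| < α ∧ |(dRot c z).im| < β} := hcar
  obtain ⟨hh1, hh2⟩ := sqrt_two_div_two_mul_bounds hδ
  -- `x` is a site of the diamond: the dart has an inner face
  have hxin : meshPoint δ x ∈ D.carrier := by
    have := corner_mem_of_isInnerFace hface (isCorner_faceAt x j)
    rwa [hEΩ, hEδ] at this
  obtain ⟨⟨hFx1, hFx2, hGx1, hGx2⟩, hnear, hbd⟩ :=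
    dartSite_block hcar' hsp0 hsqL hpk hqk hspq hδ hδη hδγ hEΩ hEδ hgood hdist hηp hηq hxin
  have hsqL' : sq ≤ 2 * gam' α β k := by rw [← dLen_eq]; exact hsqL
  -- the block of `x` is off `B`
  have hnoB : ∀ v : Site 2, |xiC k v - xiC k x| + |upC k v - upC k x| ≤ 3 → v ∉ E.zdArcB := by
    intro v hv
    obtain ⟨h1, h2, h3⟩ := hnear v (norm_meshPoint_sub_le_of_l1 hδ.le k (m := 3) (by exact_mod_cast hv))
    exact (harcs v h1 h2 h3).1
  -- `x` is a boundary site: two layers further out is outside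
  obtain ⟨hFx3, houtX⟩ := hbd x (by simp) (by simp) (E.zdArcA_subset_zdBoundary hxA)
  -- the orientation
  obtain ⟨m, rfl⟩ := exists_eq_add (k + 2) j
  have e2 : ∀ k : Fin 4, k + 2 + 2 + 1 = k + 1 ∧ k + 2 + 2 = k := by decide
  have e3 : ∀ k : Fin 4, k + 2 + 3 + 1 = k + 2 ∧ k + 2 + 3 + 2 = k + 3 ∧ k + 2 + 3 = k + 1 := by decide
  have hm : m = 0 := by
    fin_cases m
    · rfl
    · -- `j = k + 3`: the face across the outward diagonal has its far corner outside
      exfalso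
      simp only [Fin.mk_one, fin4_add_two_add_one] at hface
      rw [faceAt_wired₁] at hface
      have := corner_mem_of_isInnerFace hface (isCorner_faceAt _ _)
      rw [hEΩ, hEδ] at this
      exact houtX _ (by simp; omega) this
    · -- `j = k`: `x + u_{k+1}` on the boundary puts `x + u_k` outside, a corner of the inner face `k`
      exfalso
      simp only [Fin.reduceFinMk] at hA1 hface
      rw [(e2 k).1] at hA1
      rw [(e2 k).2] at hface
      obtain ⟨-, hout⟩ := hbd (x + cornerUnit (k + 1)) (by simp) (by simp) (E.zdArcA_subset_zdBoundary hA1)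
      have h1 : meshPoint E.δ (x + cornerUnit k) ∉ E.Ω := by rw [hEΩ, hEδ]; exact hout _ (by simp; omega)
      exact h1 (corner_mem_of_isInnerFace hface ((isCorner_add_faceAt_iff x k k).2 (Or.inl rfl)))
    · -- `j = k + 1`: `x + u_{k+2}` on the boundary puts `x + u_{k+3}` outside, yet it is on `A`
      exfalso
      simp only [Fin.reduceFinMk] at hA1 hA2
      rw [(e3 k).1] at hA1
      rw [(e3 k).2.1] at hA2
      obtain ⟨-, hout⟩ := hbd (x + cornerUnit (k + 2)) (by simp) (by simp) (E.zdArcA_subset_zdBoundary hA1)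
      have h1 : meshPoint δ (x + cornerUnit (k + 3)) ∉ D.carrier := hout _ (by simp; omega)
      have h2 := mem_of_mem_zdBoundary (E.zdArcA_subset_zdBoundary hA2)
      rw [hEΩ, hEδ] at h2
      exact h1 h2
  subst hm
  -- the inward neighbour
  have eF : Fk k (dRot c (meshPoint δ (x + cornerUnit (k + 1)))) - Fk k (dRot c (meshPoint δ x)) = Real.sqrt 2 / 2 * δ * (-1) := by
    rw [Fk_meshPoint_sub]; simp
  have eG : Gk k (dRot c (meshPoint δ (x + cornerUnit (k + 1)))) - Gk k (dRot c (meshPoint δ x)) = Real.sqrt 2 / 2 * δ * 1 := by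
    rw [Gk_meshPoint_sub]; simp
  have huin : meshPoint δ (x + cornerUnit (k + 1)) ∈ D.carrier := by
    rw [mem_carrier_iff_frame hcar' k, abs_lt, abs_lt]
    refine ⟨⟨by linarith, by linarith⟩, by linarith, by linarith⟩
  refine ⟨by simp, hxin, huin, ⟨by linarith, by linarith, by linarith, by linarith⟩, houtX, hnoB⟩

end Summit.CriticalPhenomena.CardyFormulaZ2.Cruxes.ParafermionToSLESixFamilies.PotentialDarbouxPicardDiamond

end
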